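import Mathlib
import Summits.CriticalPhenomena.SAWScalingLimit.Theorems.SAWDefectDecoherenceObservableToSLERSeqReduction

/-!
# The sequential reduction under an arbitrary family constraint
# `∀ P, CarvedSeqIdentificationP P → MidTightN → CarvedToSLENP P`

Stub `stub_seqReductionP` (stub 5c of reshape r6) of the line `bridge-gate-renewal` for the crux
`Summit.CriticalPhenomena.SAWScalingLimit.Theses.SAWDefectDecoherence.ObservableToSLER`
(item `stmt-CriticalPhenomena-14005`).  Reshape r6 (lead `prover-line-stmt-CriticalPhenomena-14005-c2-0`)
threads an ARBITRARY constraint `P D a b δ ρ R N S T` on the pair of gate families through the two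
soft transfer stubs; the landed r5 stub `stub_seqReduction`
(`Theorems/SAWDefectDecoherenceObservableToSLERSeqReduction.lean`, p117288) is the instance
`P :=` "both families exterior-anchored".  The proof is the r5 proof verbatim (by contradiction:
`R₀ := min R₀^CSI (min R₁ R₂)`; a sequence of meshes `δ_k → 0⁺` with product cells and bad tame
`P`-families from `Filter.exists_seq_forall_of_frequently`; the averaged tightness `MidTightN` at the
levels `η_j := ε / 2^{j+1}` from indices `K_j`; selection of a bad walk tight at every active level
(`SeqReduction.exists_seq_mem_diff`); its label is realised with a wide link, `ε`-bad, carries a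
probability carved law (`SeqReduction.isProbabilityMeasure_carvedLaw_of_isFirstGoodGateN`) and is
tight eventually; CSI bounds the carved integral eventually — contradiction), the fact
`hP k : P D a b (δ_k) ρ R N (S_k) (T_k)` of the extracted families being handed to CSI in place of
the two anchoring facts.
-/

noncomputable section

open scoped BigOperators Topology NNReal ENNReal Classical BoundedContinuousFunction
open Filter Set MeasureTheory Metric
open Literature.Probability.LatticeModels (HexVertex hexGraph hexCenter triZeta Site)
open Literature.Probability.RandomPlanarGeometry
open Literature.Probability.RandomPlanarGeometry.SAW

namespace Summit.CriticalPhenomena.SAWScalingLimit.Theorems.ObservableToSLER.NestedGate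

open Summit.CriticalPhenomena.SAWScalingLimit.Theorems.ObservableToSLE.Negative
  (finite_hexDomainSAW)
open Summit.CriticalPhenomena.SAWScalingLimit.Theorems.ObservableToSLER.BridgeGate
open SeqReduction

/-- **STUB 5c of the line `bridge-gate-renewal` (reshape r6): the sequential reduction under an
arbitrary family constraint `P`** — `CarvedSeqIdentificationP P` (identification cell-wise along
sequences of meshes with tame `P`-families, labels realised as widely linked first good gates,
probability carved laws with tight curve laws) and `MidTightN` (averaged tightness of the carved
middle pieces over all tame families) imply `CarvedToSLENP P` (the eventual, uniform-in-family
bound consumed by the nested transfer).  By contradiction along a bad sequence of meshes, exactly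
as the r5 `stub_seqReduction`, with the constraint `P` of the bad families handed to CSI. -/
theorem stub_seqReductionP :
    ∀ (P : DobrushinDomain → (ℝ → HexVertex) → (ℝ → HexVertex) → ℝ → ℝ → ℝ → ℕ →
      (ℕ → Set HexVertex) → (ℕ → Set HexVertex) → Prop),
    (∀ (D : DobrushinDomain) (a b : ℝ → HexVertex), IsEmbEndpointApprox hexGraph hexCenter D a b →
       ∀ (ν : Measure (CurveClass ℂ)), IsSLELaw ((8 : ℝ≥0) / 3) D ν →
       ∀ (f : CurveClass ℂ →ᵇ ℝ) (ε : ℝ), 0 < ε →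
         ∃ R₀ > (0 : ℝ), ∀ R ∈ Set.Ioc (0 : ℝ) R₀, ∀ ρ > (0 : ℝ), ∀ N : ℕ,
           ∀ (δ : ℕ → ℝ) (S T : ℕ → ℕ → Set HexVertex) (n n' : ℕ → ℕ) (q q' : ℕ → HexVertex),
             Tendsto δ atTop (𝓝[>] 0) →
             (∀ k, TameNestedFamily (δ k) R N (a (δ k)) (S k) ∧
               TameNestedFamily (δ k) R N (b (δ k)) (T k) ∧
               P D a b (δ k) ρ R N (S k) (T k)) →
             (∀ k, ∃ (γ : HexDomainSAW D.carrier (δ k) (a (δ k)) (b (δ k))) (m : ℕ) (p : HexVertex)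
                 (m' : ℕ) (p' : HexVertex),
               IsFirstGoodGateN D.carrier (δ k) ρ R (S k) (a (δ k)) γ.walk.support (n k) m p (q k) ∧
               IsFirstGoodGateN D.carrier (δ k) ρ R (T k) (b (δ k)) γ.walk.support.reverse
                 (n' k) m' p' (q' k) ∧
               WideLink D.carrier (δ k) ρ (S k (n k) ∪ T k (n' k)) (q k) (q' k)) →
             (∀ k, IsProbabilityMeasure
               (carvedLaw D.carrier (δ k) (S k (n k) ∪ T k (n' k)) (q k) (q' k))) →
             (∀ η > (0 : ℝ), ∃ 𝒦 : Set (CurveClass ℂ), IsCompact 𝒦 ∧ ∀ᶠ k in atTop,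
               carvedLaw D.carrier (δ k) (S k (n k) ∪ T k (n' k)) (q k) (q' k)
                 {ξ | ξ.curve ∉ 𝒦} ≤ ENNReal.ofReal η) →
             ∀ᶠ k in atTop,
               |(∫ ξ, f ξ.curve ∂(carvedLaw D.carrier (δ k) (S k (n k) ∪ T k (n' k)) (q k) (q' k))) -
                   ∫ x, f x ∂ν| ≤ ε) →
    (∀ (D : DobrushinDomain) (a b : ℝ → HexVertex), IsEmbEndpointApprox hexGraph hexCenter D a b →
       ∃ R₂ > (0 : ℝ), ∀ R ∈ Set.Ioc (0 : ℝ) R₂, ∀ ρ > (0 : ℝ), ∀ N : ℕ, ∀ η > (0 : ℝ),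
         ∃ 𝒦 : Set (CurveClass ℂ), IsCompact 𝒦 ∧
           ∀ᶠ δ : ℝ in 𝓝[>] 0, ∀ S T : ℕ → Set HexVertex,
             TameNestedFamily δ R N (a δ) S → TameNestedFamily δ R N (b δ) T →
             hexSAWLaw D.carrier δ (a δ) (b δ)
               {γ | ∃ (n m : ℕ) (p q : HexVertex) (n' m' : ℕ) (p' q' : HexVertex),
                   IsFirstGoodGateN D.carrier δ ρ R S (a δ) γ.walk.support n m p q ∧
                   IsFirstGoodGateN D.carrier δ ρ R T (b δ) γ.walk.support.reverse n' m' p' q' ∧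
                   ENNReal.ofReal η <
                     carvedLaw D.carrier δ (S n ∪ T n') q q' {ξ | ξ.curve ∉ 𝒦}} ≤
               ENNReal.ofReal η) →
    ∀ (D : DobrushinDomain) (a b : ℝ → HexVertex), IsEmbEndpointApprox hexGraph hexCenter D a b →
      ∀ (ν : Measure (CurveClass ℂ)), IsSLELaw ((8 : ℝ≥0) / 3) D ν →
      ∀ (f : CurveClass ℂ →ᵇ ℝ) (ε : ℝ), 0 < ε →
        ∃ R₀ > (0 : ℝ), ∀ R ∈ Set.Ioc (0 : ℝ) R₀, ∀ ρ > (0 : ℝ), ∀ N : ℕ,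
          ∀ᶠ δ : ℝ in 𝓝[>] 0, ∀ S T : ℕ → Set HexVertex,
            TameNestedFamily δ R N (a δ) S → TameNestedFamily δ R N (b δ) T →
            P D a b δ ρ R N S T →
            hexSAWLaw D.carrier δ (a δ) (b δ)
              {γ | ∃ (n m : ℕ) (p q : HexVertex) (n' m' : ℕ) (p' q' : HexVertex),
                  IsFirstGoodGateN D.carrier δ ρ R S (a δ) γ.walk.support n m p q ∧
                  IsFirstGoodGateN D.carrier δ ρ R T (b δ) γ.walk.support.reverse n' m' p' q' ∧
                  WideLink D.carrier δ ρ (S n ∪ T n') q q' ∧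
                  ε < |(∫ ξ, f ξ.curve ∂(carvedLaw D.carrier δ (S n ∪ T n') q q')) - ∫ x, f x ∂ν|} ≤
              ENNReal.ofReal ε := by
  intro P hCSI hMT D a b hab ν hν f ε hε
  obtain ⟨R₀', hR₀', hC⟩ := hCSI D a b hab ν hν f ε hε
  obtain ⟨R₁, hR₁, hcells⟩ := eventually_productCellN D a b hab
  obtain ⟨R₂, hR₂, hM⟩ := hMT D a b hab
  refine ⟨min R₀' (min R₁ R₂), lt_min hR₀' (lt_min hR₁ hR₂), ?_⟩
  rintro R ⟨hR0, hRle⟩ ρ hρ N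
  have hRR₀' : R ∈ Set.Ioc 0 R₀' := ⟨hR0, hRle.trans (min_le_left _ _)⟩
  have hRR₁ : R ∈ Set.Ioc 0 R₁ := ⟨hR0, hRle.trans ((min_le_right _ _).trans (min_le_left _ _))⟩
  have hRR₂ : R ∈ Set.Ioc 0 R₂ := ⟨hR0, hRle.trans ((min_le_right _ _).trans (min_le_right _ _))⟩
  by_contra hnot
  -- STEP 1: a sequence of meshes `δ_k → 0⁺` with product cells and bad tame anchored families
  have hev : ∀ᶠ δ : ℝ in 𝓝[>] 0, 0 < δ ∧ ∀ S T : ℕ → Set HexVertex,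
      TameNestedFamily δ R N (a δ) S → TameNestedFamily δ R N (b δ) T →
        ∀ γ₀ : HexDomainSAW D.carrier δ (a δ) (b δ),
          γ₀ ∈ productCellN D.carrier δ ρ R S T (a δ) (b δ) (3 * R) := by
    filter_upwards [self_mem_nhdsWithin, hcells R hRR₁ ρ N] with δ hδ hc
    exact ⟨hδ, hc⟩
  obtain ⟨δs, hδs, hk⟩ :=
    exists_seq_forall_of_frequently ((not_eventually.1 hnot).and_eventually hev)
  have hk' : ∀ k, ∃ S T : ℕ → Set HexVertex, TameNestedFamily (δs k) R N (a (δs k)) S ∧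
      TameNestedFamily (δs k) R N (b (δs k)) T ∧
      P D a b (δs k) ρ R N S T ∧
      ENNReal.ofReal ε < hexSAWLaw D.carrier (δs k) (a (δs k)) (b (δs k))
        {γ | ∃ (n m : ℕ) (p q : HexVertex) (n' m' : ℕ) (p' q' : HexVertex),
            IsFirstGoodGateN D.carrier (δs k) ρ R S (a (δs k)) γ.walk.support n m p q ∧
            IsFirstGoodGateN D.carrier (δs k) ρ R T (b (δs k)) γ.walk.support.reverse
              n' m' p' q' ∧
            WideLink D.carrier (δs k) ρ (S n ∪ T n') q q' ∧
            ε < |(∫ ξ, f ξ.curve ∂(carvedLaw D.carrier (δs k) (S n ∪ T n') q q')) -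
              ∫ x, f x ∂ν|} := by
    intro k
    have h := (hk k).1
    push Not at h
    obtain ⟨S, T, hS, hT, hP, hlt⟩ := h
    exact ⟨S, T, hS, hT, hP, hlt⟩
  choose S T hS hT hP hbad using hk'
  -- STEP 2: the averaged tightness at the levels `η_j := ε / 2^(j+1)`, from an index `K_j` on
  obtain ⟨ηs, hηs⟩ : ∃ ηs : ℕ → ℝ, ∀ j, ηs j = ε / 2 ^ (j + 1) := ⟨_, fun j => rfl⟩
  have hηpos : ∀ j, 0 < ηs j := fun j => by rw [hηs]; positivity
  have hj : ∀ j : ℕ, ∃ 𝒦 : Set (CurveClass ℂ), IsCompact 𝒦 ∧ ∃ Kj : ℕ, ∀ k ≥ Kj,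
      ∀ S T : ℕ → Set HexVertex, TameNestedFamily (δs k) R N (a (δs k)) S →
        TameNestedFamily (δs k) R N (b (δs k)) T →
        hexSAWLaw D.carrier (δs k) (a (δs k)) (b (δs k))
          {γ | ∃ (n m : ℕ) (p q : HexVertex) (n' m' : ℕ) (p' q' : HexVertex),
              IsFirstGoodGateN D.carrier (δs k) ρ R S (a (δs k)) γ.walk.support n m p q ∧
              IsFirstGoodGateN D.carrier (δs k) ρ R T (b (δs k)) γ.walk.support.reverse
                n' m' p' q' ∧
              ENNReal.ofReal (ηs j) <
                carvedLaw D.carrier (δs k) (S n ∪ T n') q q' {ξ | ξ.curve ∉ 𝒦}} ≤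
          ENNReal.ofReal (ηs j) := by
    intro j
    obtain ⟨𝒦, h𝒦, hevj⟩ := hM R hRR₂ ρ hρ N (ηs j) (hηpos j)
    exact ⟨𝒦, h𝒦, eventually_atTop.1 (hδs.eventually hevj)⟩
  choose 𝒦 h𝒦 K hK using hj
  -- STEP 3: selection of a bad walk, tight at every active level
  obtain ⟨γ, hγA, hγB⟩ := exists_seq_mem_diff
    (fun k => hexSAWLaw D.carrier (δs k) (a (δs k)) (b (δs k)))
    (fun k => {γ | ∃ (n m : ℕ) (p q : HexVertex) (n' m' : ℕ) (p' q' : HexVertex),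
      IsFirstGoodGateN D.carrier (δs k) ρ R (S k) (a (δs k)) γ.walk.support n m p q ∧
      IsFirstGoodGateN D.carrier (δs k) ρ R (T k) (b (δs k)) γ.walk.support.reverse
        n' m' p' q' ∧
      WideLink D.carrier (δs k) ρ (S k n ∪ T k n') q q' ∧
      ε < |(∫ ξ, f ξ.curve ∂(carvedLaw D.carrier (δs k) (S k n ∪ T k n') q q')) -
        ∫ x, f x ∂ν|})
    (fun j k => {γ | ∃ (n m : ℕ) (p q : HexVertex) (n' m' : ℕ) (p' q' : HexVertex),
      IsFirstGoodGateN D.carrier (δs k) ρ R (S k) (a (δs k)) γ.walk.support n m p q ∧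
      IsFirstGoodGateN D.carrier (δs k) ρ R (T k) (b (δs k)) γ.walk.support.reverse
        n' m' p' q' ∧
      ENNReal.ofReal (ηs j) <
        carvedLaw D.carrier (δs k) (S k n ∪ T k n') q q' {ξ | ξ.curve ∉ 𝒦 j}})
    K hbad (fun j k hjk => hK j k hjk (S k) (T k) (hS k) (hT k))
    (fun n' => by simp_rw [hηs]; exact sum_ofReal_div_two_pow_le hε.le n')
  have hγA' : ∀ k, ∃ (n m : ℕ) (p q : HexVertex) (n' m' : ℕ) (p' q' : HexVertex),
      IsFirstGoodGateN D.carrier (δs k) ρ R (S k) (a (δs k)) (γ k).walk.support n m p q ∧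
      IsFirstGoodGateN D.carrier (δs k) ρ R (T k) (b (δs k)) (γ k).walk.support.reverse
        n' m' p' q' ∧
      WideLink D.carrier (δs k) ρ (S k n ∪ T k n') q q' ∧
      ε < |(∫ ξ, f ξ.curve ∂(carvedLaw D.carrier (δs k) (S k n ∪ T k n') q q')) -
        ∫ x, f x ∂ν| := fun k => hγA k
  choose n m p q n' m' p' q' hFG hFG' hWL hεlt using hγA'
  -- STEP 4: the hypotheses of CSI along the selected labels
  have hprob : ∀ k, IsProbabilityMeasure
      (carvedLaw D.carrier (δs k) (S k (n k) ∪ T k (n' k)) (q k) (q' k)) := fun k =>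
    isProbabilityMeasure_carvedLaw_of_isFirstGoodGateN D.isBounded (hk k).2.1
      ((hk k).2.2 (S k) (T k) (hS k) (hT k) (γ k)) (hFG k) (hFG' k)
  have htight : ∀ η > (0 : ℝ), ∃ 𝒦' : Set (CurveClass ℂ), IsCompact 𝒦' ∧ ∀ᶠ k in atTop,
      carvedLaw D.carrier (δs k) (S k (n k) ∪ T k (n' k)) (q k) (q' k)
        {ξ | ξ.curve ∉ 𝒦'} ≤ ENNReal.ofReal η := by
    intro η hη
    obtain ⟨j, hjη⟩ := exists_div_two_pow_le ε hη
    rw [← hηs] at hjη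
    refine ⟨𝒦 j, h𝒦 j, (hγB j).mono fun k hk => ?_⟩
    simp only [Set.mem_setOf_eq, not_exists, not_and, not_lt] at hk
    exact (hk _ _ _ _ _ _ _ _ (hFG k) (hFG' k)).trans (ENNReal.ofReal_le_ofReal hjη)
  -- STEP 5: CSI bounds the carved integrals eventually; contradiction with badness
  have hconc := hC R hRR₀' ρ hρ N δs S T n n' q q' hδs (fun k => ⟨hS k, hT k, hP k⟩)
    (fun k => ⟨γ k, m k, p k, m' k, p' k, hFG k, hFG' k, hWL k⟩) hprob htight
  obtain ⟨k, hk⟩ := hconc.exists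
  exact (not_lt.2 hk) (hεlt k)

end Summit.CriticalPhenomena.SAWScalingLimit.Theorems.ObservableToSLER.NestedGate

end
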